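import Mathlib
import Summits.CriticalPhenomena.PercolationContinuityZ3.Theses.PercNearOneGluing
import Literature.Probability.Percolation.PercolationEvents
import Literature.Probability.Percolation.RSW
import HarnessLib

/-!
# The least-reliable-first (LRF) hitting rule implies `NearOneGluing`

Stub `stub_lrfGlue` of line `SketchR2I5` (Cycle 3) for the crux `PercNearOneGluing.NearOneGluing`
(item stmt-CriticalPhenomena-4574 = Kozma–Nitzan Conjecture 3 over all finite weighted graphs).

Setting: one finite weighted graph — vertices `Fin n`, weights `w`, `μ = prodBernoulli w` on bond configurations
`ω : Set (Sym2 (Fin n))`; relay set `A`, source `o ∉ A`, target `b`; `u(v) := μ(v ↮ b) = μ.real (openConn v b)ᶜ`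
and, for a threshold `θ`, the level-set event `reach θ x := {ω | o ↔ x inside {v | θ ≤ u v} ∪ {o}}`.

The HYPOTHESIS of `stub_lrfGlue` is the lead's LRF hitting inequality (registered as the conjectural stub
`stub_lrfGluing`): for every selector `sel` with `sel ω = some a ↔` (`a ∈ A` is reachable at some threshold, has the
largest threshold set `Θ_a = {θ | reach θ a ω}` among the relays, and the smallest index among those),
`μ(o ↮ b, o ↔ A) ≤ Σ_{a ∈ A} μ(sel = a) · u(a)`.

The CONCLUSION is `NearOneGluing`, with `δ := ε / 3`:
* `lrfGlue_clauses_unique`, `lrfGlue_exists_selector`: the three clauses single out at most one relay (two relays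
  satisfying them would each have to be reachable at a threshold where the other is not, contradicting maximality), so
  the selector `sel ω := some (that relay)` / `none` exists — by choice, no exploration needed;
* `lrfGlue_sum_sel_le_one`: the events `{sel = some a}`, `a ∈ A`, are pairwise disjoint, so their probabilities sum
  to at most `1`;
* `stub_lrfGlue`: `μ(o ↮ b, o ↔ A) ≤ Σ_a μ(sel = a) · u(a) ≤ δ · Σ_a μ(sel = a) ≤ δ` (each `u(a) < δ`), and
  `μ(o ↮ b) ≤ μ(o ↮ A) + μ(o ↮ b, o ↔ A) < δ + δ < ε`; the case `o ∈ A` is a hypothesis.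
-/

namespace Summit.CriticalPhenomena.PercolationContinuityZ3.Theorems

open MeasureTheory Set Literature.Probability.LatticeModels Literature.Probability.Percolation
open scoped Classical BigOperators

section LrfGlue

/-- **At most one relay satisfies the three LRF clauses.**  If `a₁` and `a₂` both (1) lie in `A` and are reachable,
(2) dominate every relay (`R θ a' → R θ aᵢ`), and (3) strictly beat every relay of smaller index at some threshold,
then `a₁ = a₂`: if, say, `a₁ < a₂`, clause (3) for `a₂` gives `θ` with `R θ a₂ ∧ ¬ R θ a₁`, contradicting clause (2)
for `a₁`. -/
theorem lrfGlue_clauses_unique {α : Type*} [LinearOrder α] {A : Finset α} {R : ℝ → α → Prop} {a₁ a₂ : α}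
    (h₁ : a₁ ∈ A ∧ (∃ θ, R θ a₁) ∧ (∀ a' ∈ A, ∀ θ, R θ a' → R θ a₁) ∧
      (∀ a' ∈ A, a' < a₁ → ∃ θ, R θ a₁ ∧ ¬ R θ a'))
    (h₂ : a₂ ∈ A ∧ (∃ θ, R θ a₂) ∧ (∀ a' ∈ A, ∀ θ, R θ a' → R θ a₂) ∧
      (∀ a' ∈ A, a' < a₂ → ∃ θ, R θ a₂ ∧ ¬ R θ a')) :
    a₁ = a₂ := by
  rcases lt_trichotomy a₁ a₂ with hlt | heq | hgt
  · obtain ⟨θ, hθ₂, hθ₁⟩ := h₂.2.2.2 a₁ h₁.1 hlt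
    exact absurd (h₁.2.2.1 a₂ h₂.1 θ hθ₂) hθ₁
  · exact heq
  · obtain ⟨θ, hθ₁, hθ₂⟩ := h₁.2.2.2 a₂ h₂.1 hgt
    exact absurd (h₂.2.2.1 a₁ h₁.1 θ hθ₁) hθ₂

/-- **The LRF selector exists.**  For any family of "reachability at threshold `θ`" predicates `R θ a ω` there is a
selector `sel : Ω → Option α` with `sel ω = some a` iff `a` satisfies the three LRF clauses at `ω` (membership and
reachability, maximal threshold set, minimal index): put `sel ω := some a` for the unique such `a`
(`lrfGlue_clauses_unique`) when it exists, `none` otherwise. -/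
theorem lrfGlue_exists_selector {Ω α : Type*} [LinearOrder α] (A : Finset α) (R : ℝ → α → Ω → Prop) :
    ∃ sel : Ω → Option α, ∀ ω a, sel ω = some a ↔
      (a ∈ A ∧ (∃ θ, R θ a ω) ∧ (∀ a' ∈ A, ∀ θ, R θ a' ω → R θ a ω) ∧
        (∀ a' ∈ A, a' < a → ∃ θ, R θ a ω ∧ ¬ R θ a' ω)) := by
  let Φ : Ω → α → Prop := fun ω a =>
    a ∈ A ∧ (∃ θ, R θ a ω) ∧ (∀ a' ∈ A, ∀ θ, R θ a' ω → R θ a ω) ∧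
      (∀ a' ∈ A, a' < a → ∃ θ, R θ a ω ∧ ¬ R θ a' ω)
  refine ⟨fun ω => if h : ∃ a, Φ ω a then some (Classical.choose h) else none, fun ω a => ?_⟩
  change _ ↔ Φ ω a
  by_cases h : ∃ a, Φ ω a
  · simp only [dif_pos h, Option.some.injEq]
    constructor
    · rintro rfl
      exact Classical.choose_spec h
    · intro ha
      exact lrfGlue_clauses_unique (A := A) (R := fun θ a => R θ a ω) (Classical.choose_spec h) ha
  · simp only [dif_neg h, reduceCtorEq, false_iff]
    exact fun ha => h ⟨a, ha⟩

/-- **The selection events are disjoint:** for any `sel : Ω → Option α` and a probability (or zero) measure,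
`Σ_{a ∈ A} μ{sel = some a} ≤ 1` (the events are the fibres of `sel` over `some '' A`). -/
theorem lrfGlue_sum_sel_le_one {Ω α : Type*} [MeasurableSpace Ω] [DiscreteMeasurableSpace Ω] (μ : Measure Ω)
    [IsZeroOrProbabilityMeasure μ] (A : Finset α) (sel : Ω → Option α) :
    ∑ a ∈ A, μ.real {ω | sel ω = some a} ≤ 1 := by
  have hdisj : PairwiseDisjoint (↑A : Set α) (fun a => {ω : Ω | sel ω = some a}) := by
    intro a _ a' _ hne
    refine Set.disjoint_left.2 fun ω h1 h2 => hne ?_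
    exact Option.some_injective _ ((h1 : sel ω = some a).symm.trans h2)
  rw [← measureReal_biUnion_finset hdisj (fun _ _ => MeasurableSet.of_discrete)]
  exact measureReal_le_one

/-- **The LRF hitting rule implies the crux** (stub `stub_lrfGlue` of line `SketchR2I5`, Cycle 3).
The hypothesis is the registered LRF inequality `stub_lrfGluing` verbatim; the conclusion is `NearOneGluing` with
`δ = ε / 3`.  Proof: for an instance with `o ∉ A` take the selector of `lrfGlue_exists_selector` for the level-set
reachability predicates `R θ a ω := ω ∈ openConnIn ({v | θ ≤ μ.real (openConn v b)ᶜ} ∪ {o}) o a`; the hypothesis gives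
`μ(o ↮ b, o ↔ A) ≤ Σ_a μ(sel = a) · μ(a ↮ b) ≤ (ε/3) · Σ_a μ(sel = a) ≤ ε/3` (`lrfGlue_sum_sel_le_one`), and
`μ(o ↮ b) ≤ μ(o ↮ A) + μ(o ↮ b, o ↔ A) < ε/3 + ε/3 < ε`.  If `o ∈ A` the conclusion is the hypothesis at `a = o`. -/
theorem stub_lrfGlue :
    (∀ (n : ℕ) (w : Sym2 (Fin n) → unitInterval) (A : Finset (Fin n)) (o b : Fin n), o ∉ A →
      ∀ (sel : Set (Sym2 (Fin n)) → Option (Fin n)),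
        (∀ ω a, sel ω = some a ↔
          (a ∈ A ∧
            (∃ θ : ℝ, ω ∈ openConnIn ({v : Fin n | θ ≤ (prodBernoulli w).real (openConn v b)ᶜ} ∪ {o}) o a) ∧
            (∀ a' ∈ A, ∀ θ : ℝ,
              ω ∈ openConnIn ({v : Fin n | θ ≤ (prodBernoulli w).real (openConn v b)ᶜ} ∪ {o}) o a' →
              ω ∈ openConnIn ({v : Fin n | θ ≤ (prodBernoulli w).real (openConn v b)ᶜ} ∪ {o}) o a) ∧
            (∀ a' ∈ A, a' < a → ∃ θ : ℝ,
              ω ∈ openConnIn ({v : Fin n | θ ≤ (prodBernoulli w).real (openConn v b)ᶜ} ∪ {o}) o a ∧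
              ω ∉ openConnIn ({v : Fin n | θ ≤ (prodBernoulli w).real (openConn v b)ᶜ} ∪ {o}) o a'))) →
        (prodBernoulli w).real {ω | ω ∉ openConn o b ∧ ∃ a ∈ A, ω ∈ openConn o a} ≤
          ∑ a ∈ A, (prodBernoulli w).real {ω | sel ω = some a} * (prodBernoulli w).real (openConn a b)ᶜ) →
    Summit.CriticalPhenomena.PercolationContinuityZ3.Theses.PercNearOneGluing.NearOneGluing := by
  intro hLRF ε hε
  refine ⟨ε / 3, by positivity, ?_⟩
  intro n w A o b hoA hab
  let μ := prodBernoulli w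
  change 1 - ε < μ.real (openConn o b)
  -- the case `o ∈ A` is a hypothesis
  by_cases ho : o ∈ A
  · have := hab o ho
    change 1 - ε / 3 < μ.real (openConn o b) at this
    linarith
  -- the selector and the LRF inequality
  obtain ⟨sel, hsel⟩ := lrfGlue_exists_selector (Ω := Set (Sym2 (Fin n))) A
    (fun (θ : ℝ) (a : Fin n) (ω : Set (Sym2 (Fin n))) =>
      ω ∈ openConnIn ({v : Fin n | θ ≤ μ.real (openConn v b)ᶜ} ∪ {o}) o a)
  have hineq : μ.real {ω | ω ∉ openConn o b ∧ ∃ a ∈ A, ω ∈ openConn o a} ≤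
      ∑ a ∈ A, μ.real {ω | sel ω = some a} * μ.real (openConn a b)ᶜ :=
    hLRF n w A o b ho sel hsel
  -- unreliabilities are below `ε / 3`
  have hu : ∀ a ∈ A, μ.real (openConn a b)ᶜ ≤ ε / 3 := by
    intro a ha
    rw [probReal_compl_eq_one_sub MeasurableSet.of_discrete]
    have := hab a ha
    change 1 - ε / 3 < μ.real (openConn a b) at this
    linarith
  have hbad : μ.real {ω | ω ∉ openConn o b ∧ ∃ a ∈ A, ω ∈ openConn o a} ≤ ε / 3 := by
    refine hineq.trans ?_
    calc ∑ a ∈ A, μ.real {ω | sel ω = some a} * μ.real (openConn a b)ᶜ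
        ≤ ∑ a ∈ A, μ.real {ω | sel ω = some a} * (ε / 3) :=
          Finset.sum_le_sum fun a ha => mul_le_mul_of_nonneg_left (hu a ha) measureReal_nonneg
      _ = (∑ a ∈ A, μ.real {ω | sel ω = some a}) * (ε / 3) := (Finset.sum_mul _ _ _).symm
      _ ≤ 1 * (ε / 3) :=
          mul_le_mul_of_nonneg_right (lrfGlue_sum_sel_le_one μ A sel) (by positivity)
      _ = ε / 3 := one_mul _
  -- bookkeeping
  have hcomplA : μ.real (⋃ a ∈ A, openConn o a)ᶜ < ε / 3 := by
    rw [probReal_compl_eq_one_sub MeasurableSet.of_discrete]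
    change 1 - ε / 3 < μ.real (⋃ a ∈ A, openConn o a) at hoA
    linarith
  have hcover : (openConn o b)ᶜ ⊆
      (⋃ a ∈ A, openConn o a)ᶜ ∪ {ω | ω ∉ openConn o b ∧ ∃ a ∈ A, ω ∈ openConn o a} := by
    intro ω hω
    by_cases hA : ω ∈ ⋃ a ∈ A, openConn o a
    · right
      refine ⟨hω, ?_⟩
      simpa only [Set.mem_iUnion, exists_prop] using hA
    · left
      exact hA
  have hBad : μ.real (openConn o b)ᶜ < ε := by
    calc μ.real (openConn o b)ᶜ
        ≤ μ.real ((⋃ a ∈ A, openConn o a)ᶜ ∪ {ω | ω ∉ openConn o b ∧ ∃ a ∈ A, ω ∈ openConn o a}) :=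
          measureReal_mono hcover (measure_ne_top _ _)
      _ ≤ μ.real (⋃ a ∈ A, openConn o a)ᶜ + μ.real {ω | ω ∉ openConn o b ∧ ∃ a ∈ A, ω ∈ openConn o a} :=
          measureReal_union_le _ _
      _ < ε / 3 + ε / 3 := add_lt_add_of_lt_of_le hcomplA hbad
      _ ≤ ε := by linarith
  have hfin : μ.real (openConn o b) = 1 - μ.real (openConn o b)ᶜ := by
    rw [probReal_compl_eq_one_sub (μ := μ) (s := openConn o b) MeasurableSet.of_discrete]
    ring
  rw [hfin]
  linarith

end LrfGlue

end Summit.CriticalPhenomena.PercolationContinuityZ3.Theorems
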